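import Summits.BirchSwinnertonDyer.BirchSwinnertonDyer.Theorems.EisensteinPrimesResidualDevissageNonsplitSurjective
import Summits.BirchSwinnertonDyer.BirchSwinnertonDyer.Theorems.EisensteinPrimesCharResidualStrictSelmerCount
import HarnessLib

/-!
# Keller–Yin Thm. 1.4.1's λ-identity, FINITE PARTS EXPLICIT, under CGLS's hypothesis «`φ|_{G_p} ≠ 𝟙, ω`» (good non-anomalous or
# non-split multiplicative `p`): `p^{λ(𝔛^{Sf}_f)} · #𝔛^{Sf}_f[p] = p^{λ(𝔛_φ) + λ(𝔛_ψ)} · #𝔛_φ[p] · #𝔛_ψ[p]` in the kernel modulo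
# CGLS22 Cor. 1.2.6 [PUB] and the `Λ`-torsion / `μ = 0` of the two STRICT character duals (= CGLS22 Prop. 1.2.5, first clause)
# (cell `bsd-eis`, seat `bsd-line-x2-p2` gen 6, D-0154 KEY row 5; crux 4 `BSDpOnCellC` stmt-BirchSwinnertonDyer-19034, line b1; sequel of
# `…ResidualDevissageNonsplitSurjective` and `…CharResidualStrictSelmerCount`)

HONEST FRAMING (cell `bsd-eis`, run/shared/lean/pub/bsd-eis/): Galois-cohomology / module-theoretic bookkeeping on constructed
objects; no definition, no named fact, no `sorry`, no `Theses` import; nothing about BSD or a main conjecture is asserted; nothing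
booked; no label or count moves. Helper `--supports stmt-BirchSwinnertonDyer-19034`; closes no stub. CONDITIONAL on the two
PUBLISHED clauses of CGLS22 Cor. 1.2.6 (`cor126_residualCharacter_globalLift` / `…_localSurjective`, p639393) and on the HYPOTHESIS
that the strict duals `𝔛_φ = H¹_{𝓕_Gr^{Sf}}(K_∞, (F/𝒪)(φ))^∨`, `𝔛_ψ` (tree: `KellerYin2024.GrDualData`) are finitely generated
`Λ`-torsion with `μ = 0` — CGLS22 Prop. 1.2.5's first clause (Rubin 1991 + Hida 2010), not yet a named fact in this currency.

## What
`0 → S → E_K[p] → E_K[p]/S → 0` a `Γ_K`-stable line of `E_K[p]` for `E = W/ℚ` base-changed to an imaginary quadratic `K`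
(Heegner for `N_E`, `(p)` split, `2 < p`), `v̄ ∋ p` the STRICT place, `κ` anticyclotomic with generator `γ`, `Sf` = the places of
`K` over `N_E` off `p`; `D_{v̄}` neither trivial nor cyclotomic on `S` and on `E_K[p]/S` (CGLS «`φ|_{G_p} ≠ 𝟙, ω`»); `θsub`,
`θquot : Γ_K → GL₁(𝒪)` with `θ^{p−1} = 1` and equivariant embeddings `S ↪ (F/𝒪)(θsub)`, `E_K[p]/S ↪ (F/𝒪)(θquot)` onto the
`p`-torsion (for a RESIDUAL PAIR of `E_K[p]` these are `ResidualPairStableLine.exists_stableLine_of_isResidualPairOver`, x1 cell).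

* §1 `pow_lambdaInvariant_mul_eq_of_finite_of_cor126` — part 2's identity with the two residual finiteness inputs as HYPOTHESES
  (instead of `prop14`): `R(S)`, `R(E_K[p]/S)` finite ∧ Cor. 1.2.6 ⟹ `p^{λ(X^{Sf})} · #X^{Sf}[p] = #R(S) · #R(E_K[p]/S)`.
* §2 **`pow_lambdaInvariant_mul_eq_pow_mul_of_grDualData_of_cor126`** — with strict dual data `Dsub`, `Dquot` of `(F/𝒪)(θsub)`,
  `(F/𝒪)(θquot)` at `(v̄, Sf)` that are f.g. `Λ`-torsion with `μ = 0`: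
  **`p^{λ(X^{Sf})} · #X^{Sf}[p] = (p^{λ(Dsub.X)} · #Dsub.X[p]) · (p^{λ(Dquot.X)} · #Dquot.X[p])`** (§1 + part 3's
  `natCard_residualStrictSelmer_eq_pow_lambdaInvariant_mul` twice; finiteness from `finite_residualStrictSelmer_of_grDualData`).
* §3 **`lambdaInvariant_le_add_of_grDualData_of_cor126`** / **`…_eq_add_…`** — if moreover `Dsub.X`, `Dquot.X` have no `p`-torsion
  (CGLS Prop. 1.2.5: «`𝔛_θ^S` is a free `ℤ_p`-module»): `p^{λ(X^{Sf})} · #X^{Sf}[p] = p^{λ(Dsub.X) + λ(Dquot.X)}`, hence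
  **`λ(X^{Sf}) ≤ λ(Dsub.X) + λ(Dquot.X)`**, with EQUALITY as soon as `X^{Sf}` has no `p`-torsion («no finite `Λ`-submodule»,
  CGLS Cor. 1.4.3 / Keller–Yin (e)) — Keller–Yin Thm. 1.4.1's `λ(𝔛^S_f) = λ(𝔛^S_φ) + λ(𝔛^S_ψ)` (case `ψ|_{G_K} ≠ 𝟙`, automatic
  here) in the kernel, with its one remaining E-level input isolated as the hypothesis `X^{Sf}[p] = 0`.

The non-split multiplicative Eisenstein datum supplies the four local hypotheses (part 1,
`exists_stableSubgroup_localData_of_not_split`); the anomalous cases (one character IS `𝟙` or `ω` at `v̄`) are NOT covered.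

References: [CastellaGrossiLeeSkinner2022] §1.2 Prop. 1.2.5, Cor. 1.2.6, §1.4 Props. 1.4.1–1.4.2, Cor. 1.4.3, Thm. 1.5.1 (e-print TeX
L681–931; arXiv:2008.02571 Prop. 14, Cor. 15, Props. 17–18, Cor. 19, Thm. 20); [KellerYin2024] Thm. 1.4.1, Lemma 5.1.1 (arXiv:2402.12781v2);
[GreenbergVatsal2000] §2 Prop. (2.8); cell p640605, p639968 (this seat), p639105 / `…CharResidualSelmerKummer` (x1 cell).
-/

set_option autoImplicit false
set_option linter.dupNamespace false -- the summit namespace `…BirchSwinnertonDyer.BirchSwinnertonDyer.Theorems` (Sub = Summit, D-0017) trips it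

noncomputable section

open scoped Classical Pointwise

namespace Summit.BirchSwinnertonDyer.BirchSwinnertonDyer.Theorems.ResidualDevissageNonsplitLambdaIdentity

open WeierstrassCurve NumberField IsDedekindDomain Field
  Literature.NumberTheory.EllipticCurves Literature.NumberTheory.EllipticCurves.IwasawaAlgebra
  Literature.NumberTheory.EllipticCurves.GreenbergSelmer
  Literature.NumberTheory.EllipticCurves.GreenbergVatsal2000
  Literature.NumberTheory.GaloisRepresentations IsDedekindDomain.HeightOneSpectrum
  Literature.NumberTheory.EllipticCurves.Rank1Residual Literature.NumberTheory.EllipticCurves.KellerYin2024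
  Summit.BirchSwinnertonDyer.Rank1Residual.X11b Summit.BirchSwinnertonDyer.Rank1Residual.X11b.AcSelmer
  Summit.BirchSwinnertonDyer.Rank1Residual.X2.ResidualDevissageModules
  Summit.BirchSwinnertonDyer.BirchSwinnertonDyer.Theorems
  Summit.BirchSwinnertonDyer.BirchSwinnertonDyer.Theorems.ResidualDevissageCountNonsplit
  Summit.BirchSwinnertonDyer.BirchSwinnertonDyer.Theorems.ResidualDevissageCountNonsplitIdentity
  Summit.BirchSwinnertonDyer.BirchSwinnertonDyer.Theorems.ResidualDevissageNonsplitLocal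
  Summit.BirchSwinnertonDyer.BirchSwinnertonDyer.Theorems.ResidualDevissageSurjectivity
  Summit.BirchSwinnertonDyer.BirchSwinnertonDyer.Theorems.ResidualDevissageNonsplitLocalData
  Summit.BirchSwinnertonDyer.BirchSwinnertonDyer.Theorems.ResidualDevissageNonsplitSurjective
  Summit.BirchSwinnertonDyer.BirchSwinnertonDyer.Theorems.CharResidualStrictSelmerCount
  Summit.BirchSwinnertonDyer.BirchSwinnertonDyer.Theorems.CumulativeHeegnerInclusionAtThreeResidualDevissage
  Summit.BirchSwinnertonDyer.BirchSwinnertonDyer.Theorems.CumulativeHeegnerInclusionAtThreeTowerFixed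
open Literature.NumberTheory.EllipticCurves.CastellaGrossiLeeSkinner2022
  (cor126_residualCharacter_globalLift cor126_residualCharacter_localSurjective)

variable {p : ℕ} [hp : Fact p.Prime]

/-! ### §1 The identity with the residual finiteness as hypotheses -/

/-- **`R(S)`, `R(E_K[p]/S)` finite ∧ CGLS22 Cor. 1.2.6 ⟹ `p^{λ(X^{Sf})} · #X^{Sf}[p] = #R(S) · #R(E_K[p]/S)`** along a stable line
whose two characters avoid `{𝟙, ω}` at `v̄` — part 2's `pow_lambdaInvariant_mul_eq_of_prop14_of_cor126` with the two finiteness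
inputs as HYPOTHESES (so that they can be fed from any currency, e.g. the strict character duals of part 3) instead of from
`prop14_residualCharacterSelmer_finite`. Same proof: «`≤`» without error term (no fixed quotient vector), «`≥`» by the residual
surjectivity `residualSurjective_of_cor126`; (L) at `v̄` from the local hypotheses.
[cite: CastellaGrossiLeeSkinner2022, §1.2 Cor. 1.2.6, §1.4 Props. 1.4.1–1.4.2 (e-print TeX L727–880)] [cite: KellerYin2024, Thm. 1.4.1 (arXiv:2402.12781v2 §1.4)] -/
theorem pow_lambdaInvariant_mul_eq_of_finite_of_cor126
    (hlift : cor126_residualCharacter_globalLift) (hlocal : cor126_residualCharacter_localSurjective)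
    (W : WeierstrassCurve ℚ) [W.IsElliptic]
    (K : Type) [Field K] [NumberField K] (vbar : HeightOneSpectrum (𝓞 K))
    (κ : ZpExtension K p) (γ : absoluteGaloisGroup K) [Fact (κ.IsTopGenerator γ)]
    (Sf : Finset (HeightOneSpectrum (𝓞 K)))
    (hp2 : 2 < p) (hK : IsImaginaryQuadratic K) (hH : SatisfiesHeegnerHypothesis (W.conductorNorm ℤ) K)
    (hsplit : ((Ideal.span {(p : ℤ)}).primesOver (𝓞 K)).ncard = 2)
    (hvbar : ((p : ℕ) : 𝓞 K) ∈ vbar.asIdeal) (hκ : κ.IsAnticyclotomic)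
    (hSf : ∀ w : HeightOneSpectrum (𝓞 K), w ∈ Sf ↔
      (((W.conductorNorm ℤ : ℤ) : 𝓞 K) ∈ w.asIdeal ∧ ((p : ℕ) : 𝓞 K) ∉ w.asIdeal))
    (S : StableSubgroup (absoluteGaloisGroup K) ((W.baseChange K).geomTorsion ((p : ℕ) : ℤ)))
    (hSub : Nat.card S.Sub = p) (hQuot : Nat.card S.Quot = p)
    (hnon1 : ¬ ∀ g ∈ decomp vbar, ∀ x : S.Sub, g • x = x) (hnon2 : ¬ ∀ g ∈ decomp vbar, ∀ y : S.Quot, g • y = y)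
    (hωS : ¬ ∀ g ∈ decomp vbar, ∀ m : S.Sub,
      g • m = ((modNCyclotomicCharacter K p g : (ZMod p)ˣ) : ZMod p).val • m)
    (hΦ : (datumStrictSelmer κ.kerSubgroup S.Sub p (AcSelmer.bdpData S.Sub p vbar) (↑Sf : Set (HeightOneSpectrum (𝓞 K))) :
      Set (Literature.NumberTheory.EllipticCurves.subgroupH1 κ.kerSubgroup S.Sub)).Finite)
    (hΨ : (datumStrictSelmer κ.kerSubgroup S.Quot p (AcSelmer.bdpData S.Quot p vbar) (↑Sf : Set (HeightOneSpectrum (𝓞 K))) :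
      Set (Literature.NumberTheory.EllipticCurves.subgroupH1 κ.kerSubgroup S.Quot)).Finite) :
    p ^ lambdaInvariant p (XAc (W.baseChange K) p κ vbar (↑Sf : Set (HeightOneSpectrum (𝓞 K))) γ) *
        Nat.card {x : XAc (W.baseChange K) p κ vbar (↑Sf : Set (HeightOneSpectrum (𝓞 K))) γ // p • x = 0} =
      Nat.card (datumStrictSelmer κ.kerSubgroup S.Sub p (AcSelmer.bdpData S.Sub p vbar)
          (↑Sf : Set (HeightOneSpectrum (𝓞 K)))) *
        Nat.card (datumStrictSelmer κ.kerSubgroup S.Quot p (AcSelmer.bdpData S.Quot p vbar)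
          (↑Sf : Set (HeightOneSpectrum (𝓞 K)))) := by
  have hp2' : p ≠ 2 := by omega
  haveI hEK : (W.baseChange K).IsElliptic := inferInstanceAs (W.map (algebraMap ℚ K)).IsElliptic
  have hsurjR := residualSurjective_of_cor126 hlift hlocal W K vbar κ Sf hp2 hK hH hsplit hvbar hκ hSf S hSub hnon1 hωS
  obtain ⟨-, hgood⟩ := sf_split_and_good (p := p) W K Sf hH hSf
  set S₀ : Set (HeightOneSpectrum (𝓞 K)) := (↑Sf : Set (HeightOneSpectrum (𝓞 K))) with hS₀
  have hS₀fin : S₀.Finite := Sf.finite_toSet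
  -- no fixed vectors up the tower, (L) at `v̄`, Brink, representatives for `S`
  have hfixS : ∀ x : S.Sub, (∀ g : ↥(κ.kerSubgroup ⊓ decomp vbar), g • x = x) → x = 0 :=
    eq_zero_of_fixed_of_not_forall_decomp_smul_eq κ vbar hSub hnon1
  have hfix : ∀ y : S.Quot, (∀ g : ↥(κ.kerSubgroup ⊓ decomp vbar), g • y = y) → y = 0 :=
    eq_zero_of_fixed_of_not_forall_decomp_smul_eq κ vbar hQuot hnon2
  have hL : ∀ m : (W.baseChange K).geomPrimaryTorsion p,
      (∀ σ ∈ κ.kerSubgroup ⊓ decomp vbar, σ • m = m) → p • m = 0 → m = 0 :=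
    noFixedPTorsion_of_forall_fixed_torsion_eq_zero (W.baseChange K) (κ.kerSubgroup ⊓ decomp vbar)
      (forall_fixed_torsion_eq_zero_of_stableSubgroup (W.baseChange K) (κ.kerSubgroup ⊓ decomp vbar) S
        (fun x hx ↦ hfixS x fun g ↦ hx g.1 g.2) (fun y hy ↦ hfix y fun g ↦ hy g.1 g.2))
  have h𝔭dec : ¬ (decomp vbar ≤ κ.kerSubgroup) :=
    ZpExtension.decomp_not_le_kerSubgroup_above_of_isAnticyclotomic_holds K p hK hp2' κ hκ vbar hvbar
  obtain ⟨c, hc⟩ := UniversalToricDescentResidualSelmerFinite.forall_resOfLe_conjH1_eq_zero_of_reps (M := S.Sub)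
    (κ := κ) vbar h𝔭dec
  have hτex : ∀ i : ℕ, ∃ τ : absoluteGaloisGroup K, κ τ = Multiplicative.ofAdd ((i : ℕ) : ℤ_[p]) :=
    fun i ↦ κ.surjective _
  choose τ hτ using hτex
  -- «≤»: no error term (no fixed quotient vector)
  have hle := pow_lambdaInvariant_le_of_stableSubgroup_fixed (W.baseChange K) κ γ hp2' hvbar h𝔭dec hS₀fin hgood hL S c τ
    (hc τ hτ) hΦ hΨ
  haveI : Subsingleton {y : S.Quot // ∀ g : ↥(κ.kerSubgroup ⊓ decomp vbar), g • y = y} :=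
    ⟨fun x y ↦ Subtype.ext ((hfix x.1 x.2).trans (hfix y.1 y.2).symm)⟩
  haveI : Nonempty {y : S.Quot // ∀ g : ↥(κ.kerSubgroup ⊓ decomp vbar), g • y = y} := ⟨⟨0, fun g ↦ smul_zero g⟩⟩
  have h1 : Nat.card {y : S.Quot // ∀ g : ↥(κ.kerSubgroup ⊓ decomp vbar), g • y = y} = 1 := Nat.card_unique
  rw [h1, one_pow, mul_one] at hle
  -- «≥»: the residual surjectivity
  have hfin := ResidualDevissageFiniteKernel.finite_selmerAc_pTorsion_of_line_devissage_of_finite (W.baseChange K) κ hvbar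
    h𝔭dec hgood S hΦ hΨ
  have h2 := UniversalToricDescentResidualSelmerExact.natCard_residualSelmer_eq_natCard_selmerAc_pTorsion (W.baseChange K)
    κ hp2' hvbar hgood hL
  haveI : Finite {s : selmerAc (W.baseChange K) p κ vbar S₀ // p • s = 0} := hfin.to_subtype
  haveI : Nonempty {s : selmerAc (W.baseChange K) p κ vbar S₀ // p • s = 0} := ⟨⟨0, smul_zero _⟩⟩
  have hE : (datumStrictSelmer κ.kerSubgroup ((W.baseChange K).geomTorsion (p : ℤ)) p (AcSelmer.bdpData _ p vbar) S₀ :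
      Set (Literature.NumberTheory.EllipticCurves.subgroupH1 κ.kerSubgroup ((W.baseChange K).geomTorsion (p : ℤ)))).Finite := by
    refine Set.finite_coe_iff.mp (Nat.finite_of_card_ne_zero ?_)
    change Nat.card (datumStrictSelmer κ.kerSubgroup ((W.baseChange K).geomTorsion (p : ℤ)) p
      (AcSelmer.bdpData _ p vbar) S₀) ≠ 0
    rw [h2]
    exact (Nat.card_pos (α := {s : selmerAc (W.baseChange K) p κ vbar S₀ // p • s = 0})).ne'
  have hge := mul_natCard_le_pow_lambdaInvariant_mul_of_surjective_of_noFixed (W.baseChange K) κ γ hp2' hvbar hS₀fin hgood hL S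
    hfix hE hsurjR
  exact le_antisymm hle hge

/-! ### §2 In the currency of the STRICT character duals (CGLS's `𝔛_θ^S`) -/

/-- **`p^{λ(X^{Sf})} · #X^{Sf}[p] = (p^{λ(𝔛_sub)} · #𝔛_sub[p]) · (p^{λ(𝔛_quot)} · #𝔛_quot[p])`** — CGLS Props. 1.4.1–1.4.2 /
Keller–Yin Thm. 1.4.1 in the currency of the STRICT character duals `𝔛_sub = Dsub.X`, `𝔛_quot = Dquot.X`
(`KellerYin2024.GrDualData` of `(F/𝒪)(θsub)`, `(F/𝒪)(θquot)` at `(v̄, Sf)`, i.e. CGLS's `𝔛^S_φ`, `𝔛^S_ψ`), FINITE PARTS EXPLICIT, along a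
stable line `S ≤ E_K[p]` with equivariant embeddings `S ↪ (F/𝒪)(θsub)`, `E_K[p]/S ↪ (F/𝒪)(θquot)` onto the `p`-torsion
(`θ^{p−1} = 1`) whose two characters avoid `{𝟙, ω}` at `v̄`. HYPOTHESES: the two PUBLISHED clauses of CGLS22 Cor. 1.2.6, and
`Dsub.X`, `Dquot.X` finitely generated `Λ`-torsion with `μ = 0` (= CGLS22 Prop. 1.2.5's first clause for `θ|_{G_v̄} ≠ 𝟙, ω`).
Proof: §1 with the finiteness from part 3 (`finite_residualStrictSelmer_of_grDualData`), then
`natCard_residualStrictSelmer_eq_pow_lambdaInvariant_mul` for each character. No preprint input, no (L), no (S), no reduction type.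
[cite: CastellaGrossiLeeSkinner2022, §1.2 Prop. 1.2.5, Cor. 1.2.6, §1.4 Props. 1.4.1–1.4.2 (e-print TeX L681–880; arXiv:2008.02571 Prop. 14, Cor. 15, Props. 17–18)]
[cite: KellerYin2024, Thm. 1.4.1, Lemma 1.2.4 (arXiv:2402.12781v2)] [cite: GreenbergVatsal2000, §2 Prop. (2.8)] -/
theorem pow_lambdaInvariant_mul_eq_pow_mul_of_grDualData_of_cor126
    (hlift : cor126_residualCharacter_globalLift) (hlocal : cor126_residualCharacter_localSurjective)
    (W : WeierstrassCurve ℚ) [W.IsElliptic]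
    (K : Type) [Field K] [NumberField K] (vbar : HeightOneSpectrum (𝓞 K))
    (κ : ZpExtension K p) (γ : absoluteGaloisGroup K) [Fact (κ.IsTopGenerator γ)]
    (Sf : Finset (HeightOneSpectrum (𝓞 K)))
    (hp2 : 2 < p) (hK : IsImaginaryQuadratic K) (hH : SatisfiesHeegnerHypothesis (W.conductorNorm ℤ) K)
    (hsplit : ((Ideal.span {(p : ℤ)}).primesOver (𝓞 K)).ncard = 2)
    (hvbar : ((p : ℕ) : 𝓞 K) ∈ vbar.asIdeal) (hκ : κ.IsAnticyclotomic)
    (hSf : ∀ w : HeightOneSpectrum (𝓞 K), w ∈ Sf ↔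
      (((W.conductorNorm ℤ : ℤ) : 𝓞 K) ∈ w.asIdeal ∧ ((p : ℕ) : 𝓞 K) ∉ w.asIdeal))
    (S : StableSubgroup (absoluteGaloisGroup K) ((W.baseChange K).geomTorsion ((p : ℕ) : ℤ)))
    (hSub : Nat.card S.Sub = p) (hQuot : Nat.card S.Quot = p)
    (hnon1 : ¬ ∀ g ∈ decomp vbar, ∀ x : S.Sub, g • x = x) (hnon2 : ¬ ∀ g ∈ decomp vbar, ∀ y : S.Quot, g • y = y)
    (hωS : ¬ ∀ g ∈ decomp vbar, ∀ m : S.Sub,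
      g • m = ((modNCyclotomicCharacter K p g : (ZMod p)ˣ) : ZMod p).val • m)
    (θsub θquot : FramedGaloisRep K (padicCoeffIntegers (∅ : Set (PadicAlgCl p))) 1)
    (hθsub : ∀ σ : absoluteGaloisGroup K, θsub σ ^ (p - 1) = 1)
    (hθquot : ∀ σ : absoluteGaloisGroup K, θquot σ ^ (p - 1) = 1)
    (jsub : S.Sub →+ charModule (∅ : Set (PadicAlgCl p)) θsub)
    (hjsub : ∀ (σ : absoluteGaloisGroup K) (a : S.Sub), jsub (σ • a) = σ • jsub a) (hjsub_inj : Function.Injective jsub)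
    (hjsub_range : ∀ x : charModule (∅ : Set (PadicAlgCl p)) θsub, x ∈ jsub.range ↔ p • x = 0)
    (jquot : S.Quot →+ charModule (∅ : Set (PadicAlgCl p)) θquot)
    (hjquot : ∀ (σ : absoluteGaloisGroup K) (a : S.Quot), jquot (σ • a) = σ • jquot a)
    (hjquot_inj : Function.Injective jquot)
    (hjquot_range : ∀ x : charModule (∅ : Set (PadicAlgCl p)) θquot, x ∈ jquot.range ↔ p • x = 0)
    (Dsub : GrDualData κ (charModule (∅ : Set (PadicAlgCl p)) θsub) vbar (↑Sf : Set (HeightOneSpectrum (𝓞 K))) γ)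
    (Dquot : GrDualData κ (charModule (∅ : Set (PadicAlgCl p)) θquot) vbar (↑Sf : Set (HeightOneSpectrum (𝓞 K))) γ)
    [Module.Finite (IwasawaAlgebra p) Dsub.X] [Module.Finite (IwasawaAlgebra p) Dquot.X]
    (hTsub : Module.IsTorsion (IwasawaAlgebra p) Dsub.X) (hμsub : muInvariant p Dsub.X = 0)
    (hTquot : Module.IsTorsion (IwasawaAlgebra p) Dquot.X) (hμquot : muInvariant p Dquot.X = 0) :
    p ^ lambdaInvariant p (XAc (W.baseChange K) p κ vbar (↑Sf : Set (HeightOneSpectrum (𝓞 K))) γ) *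
        Nat.card {x : XAc (W.baseChange K) p κ vbar (↑Sf : Set (HeightOneSpectrum (𝓞 K))) γ // p • x = 0} =
      (p ^ lambdaInvariant p Dsub.X * Nat.card {x : Dsub.X // p • x = 0}) *
        (p ^ lambdaInvariant p Dquot.X * Nat.card {x : Dquot.X // p • x = 0}) := by
  have hΦ := CharResidualStrictSelmerCount.finite_residualStrictSelmer_of_grDualData θsub κ vbar
    (↑Sf : Set (HeightOneSpectrum (𝓞 K))) hθsub jsub hjsub hjsub_inj hjsub_range Dsub hTsub hμsub
  have hΨ := CharResidualStrictSelmerCount.finite_residualStrictSelmer_of_grDualData θquot κ vbar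
    (↑Sf : Set (HeightOneSpectrum (𝓞 K))) hθquot jquot hjquot hjquot_inj hjquot_range Dquot hTquot hμquot
  rw [pow_lambdaInvariant_mul_eq_of_finite_of_cor126 hlift hlocal W K vbar κ γ Sf hp2 hK hH hsplit hvbar hκ hSf S hSub hQuot
      hnon1 hnon2 hωS hΦ hΨ,
    CharResidualStrictSelmerCount.natCard_residualStrictSelmer_eq_pow_lambdaInvariant_mul θsub κ vbar _ hθsub jsub hjsub
      hjsub_inj hjsub_range Dsub hTsub hμsub,
    CharResidualStrictSelmerCount.natCard_residualStrictSelmer_eq_pow_lambdaInvariant_mul θquot κ vbar _ hθquot jquot hjquot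
      hjquot_inj hjquot_range Dquot hTquot hμquot]

/-! ### §3 λ-currency: `λ(X^{Sf}) ≤ λ(𝔛_sub) + λ(𝔛_quot)`, with equality iff `X^{Sf}` has no `p`-torsion -/

/-- **Keller–Yin Thm. 1.4.1's λ-identity up to the finite part of `𝔛^S_f`.** Under the hypotheses of §2 and ASSUMING the two
strict character duals have no `p`-torsion (CGLS Prop. 1.2.5: «`𝔛_θ^S` is a free `ℤ_p`-module», equivalently
`dim_𝔽 H¹_{𝓕_Gr^S}(K, M_θ[p]) = λ(𝔛_θ^S)`): **`p^{λ(X^{Sf})} · #X^{Sf}[p] = p^{λ(Dsub.X) + λ(Dquot.X)}`**, so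
**`λ(X^{Sf}) ≤ λ(Dsub.X) + λ(Dquot.X)`** and **equality holds if `X^{Sf}` has no `p`-torsion** (no non-zero finite `Λ`-submodule —
CGLS Cor. 1.4.3 / Greenberg–Vatsal Prop. 2.5, the ONE remaining E-level input of the λ-identity at a non-split multiplicative
Eisenstein prime, isolated here as a hypothesis). KY: «`λ(𝔛^S_f) = λ(𝔛^S_φ) + λ(𝔛^S_ψ)` if `ψ|_{G_K} ≠ 𝟙`» — the `+1` case
cannot occur when `D_{v̄}` fixes no quotient vector. [cite: KellerYin2024, Thm. 1.4.1 (arXiv:2402.12781v2 TeX L1087–1098)]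
[cite: CastellaGrossiLeeSkinner2022, §1.2 Prop. 1.2.5 ("𝔛_θ^S is a free ℤ_p-module"), §1.4 Cor. 1.4.3, Thm. 1.5.1 (e-print TeX L681–931)]
[cite: GreenbergVatsal2000, §2 Prop. (2.5), (2.8)] -/
theorem lambdaInvariant_le_add_of_grDualData_of_cor126
    (hlift : cor126_residualCharacter_globalLift) (hlocal : cor126_residualCharacter_localSurjective)
    (W : WeierstrassCurve ℚ) [W.IsElliptic]
    (K : Type) [Field K] [NumberField K] (vbar : HeightOneSpectrum (𝓞 K))
    (κ : ZpExtension K p) (γ : absoluteGaloisGroup K) [Fact (κ.IsTopGenerator γ)]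
    (Sf : Finset (HeightOneSpectrum (𝓞 K)))
    (hp2 : 2 < p) (hK : IsImaginaryQuadratic K) (hH : SatisfiesHeegnerHypothesis (W.conductorNorm ℤ) K)
    (hsplit : ((Ideal.span {(p : ℤ)}).primesOver (𝓞 K)).ncard = 2)
    (hvbar : ((p : ℕ) : 𝓞 K) ∈ vbar.asIdeal) (hκ : κ.IsAnticyclotomic)
    (hSf : ∀ w : HeightOneSpectrum (𝓞 K), w ∈ Sf ↔
      (((W.conductorNorm ℤ : ℤ) : 𝓞 K) ∈ w.asIdeal ∧ ((p : ℕ) : 𝓞 K) ∉ w.asIdeal))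
    (S : StableSubgroup (absoluteGaloisGroup K) ((W.baseChange K).geomTorsion ((p : ℕ) : ℤ)))
    (hSub : Nat.card S.Sub = p) (hQuot : Nat.card S.Quot = p)
    (hnon1 : ¬ ∀ g ∈ decomp vbar, ∀ x : S.Sub, g • x = x) (hnon2 : ¬ ∀ g ∈ decomp vbar, ∀ y : S.Quot, g • y = y)
    (hωS : ¬ ∀ g ∈ decomp vbar, ∀ m : S.Sub,
      g • m = ((modNCyclotomicCharacter K p g : (ZMod p)ˣ) : ZMod p).val • m)
    (θsub θquot : FramedGaloisRep K (padicCoeffIntegers (∅ : Set (PadicAlgCl p))) 1)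
    (hθsub : ∀ σ : absoluteGaloisGroup K, θsub σ ^ (p - 1) = 1)
    (hθquot : ∀ σ : absoluteGaloisGroup K, θquot σ ^ (p - 1) = 1)
    (jsub : S.Sub →+ charModule (∅ : Set (PadicAlgCl p)) θsub)
    (hjsub : ∀ (σ : absoluteGaloisGroup K) (a : S.Sub), jsub (σ • a) = σ • jsub a) (hjsub_inj : Function.Injective jsub)
    (hjsub_range : ∀ x : charModule (∅ : Set (PadicAlgCl p)) θsub, x ∈ jsub.range ↔ p • x = 0)
    (jquot : S.Quot →+ charModule (∅ : Set (PadicAlgCl p)) θquot)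
    (hjquot : ∀ (σ : absoluteGaloisGroup K) (a : S.Quot), jquot (σ • a) = σ • jquot a)
    (hjquot_inj : Function.Injective jquot)
    (hjquot_range : ∀ x : charModule (∅ : Set (PadicAlgCl p)) θquot, x ∈ jquot.range ↔ p • x = 0)
    (Dsub : GrDualData κ (charModule (∅ : Set (PadicAlgCl p)) θsub) vbar (↑Sf : Set (HeightOneSpectrum (𝓞 K))) γ)
    (Dquot : GrDualData κ (charModule (∅ : Set (PadicAlgCl p)) θquot) vbar (↑Sf : Set (HeightOneSpectrum (𝓞 K))) γ)
    [Module.Finite (IwasawaAlgebra p) Dsub.X] [Module.Finite (IwasawaAlgebra p) Dquot.X]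
    (hTsub : Module.IsTorsion (IwasawaAlgebra p) Dsub.X) (hμsub : muInvariant p Dsub.X = 0)
    (hTquot : Module.IsTorsion (IwasawaAlgebra p) Dquot.X) (hμquot : muInvariant p Dquot.X = 0)
    (hfreesub : ∀ x : Dsub.X, p • x = 0 → x = 0) (hfreequot : ∀ x : Dquot.X, p • x = 0 → x = 0) :
    p ^ lambdaInvariant p (XAc (W.baseChange K) p κ vbar (↑Sf : Set (HeightOneSpectrum (𝓞 K))) γ) *
          Nat.card {x : XAc (W.baseChange K) p κ vbar (↑Sf : Set (HeightOneSpectrum (𝓞 K))) γ // p • x = 0} =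
        p ^ (lambdaInvariant p Dsub.X + lambdaInvariant p Dquot.X) ∧
      lambdaInvariant p (XAc (W.baseChange K) p κ vbar (↑Sf : Set (HeightOneSpectrum (𝓞 K))) γ) ≤
        lambdaInvariant p Dsub.X + lambdaInvariant p Dquot.X ∧
      ((∀ x : XAc (W.baseChange K) p κ vbar (↑Sf : Set (HeightOneSpectrum (𝓞 K))) γ, p • x = 0 → x = 0) →
        lambdaInvariant p (XAc (W.baseChange K) p κ vbar (↑Sf : Set (HeightOneSpectrum (𝓞 K))) γ) =
          lambdaInvariant p Dsub.X + lambdaInvariant p Dquot.X) := by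
  have hpp : p.Prime := hp.out
  have h := pow_lambdaInvariant_mul_eq_pow_mul_of_grDualData_of_cor126 hlift hlocal W K vbar κ γ Sf hp2 hK hH hsplit hvbar hκ hSf
    S hSub hQuot hnon1 hnon2 hωS θsub θquot hθsub hθquot jsub hjsub hjsub_inj hjsub_range jquot hjquot hjquot_inj hjquot_range
    Dsub Dquot hTsub hμsub hTquot hμquot
  -- the character duals have no `p`-torsion: their `[p]`-factors are `1`
  haveI : Subsingleton {x : Dsub.X // p • x = 0} :=
    ⟨fun x y ↦ Subtype.ext ((hfreesub x.1 x.2).trans (hfreesub y.1 y.2).symm)⟩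
  haveI : Subsingleton {x : Dquot.X // p • x = 0} :=
    ⟨fun x y ↦ Subtype.ext ((hfreequot x.1 x.2).trans (hfreequot y.1 y.2).symm)⟩
  haveI : Nonempty {x : Dsub.X // p • x = 0} := ⟨⟨0, smul_zero _⟩⟩
  haveI : Nonempty {x : Dquot.X // p • x = 0} := ⟨⟨0, smul_zero _⟩⟩
  rw [Nat.card_unique (α := {x : Dsub.X // p • x = 0}), Nat.card_unique (α := {x : Dquot.X // p • x = 0}), mul_one, mul_one,
    ← pow_add] at h
  -- the `X`-side `[p]`-factor is a positive natural number
  set lam := lambdaInvariant p (XAc (W.baseChange K) p κ vbar (↑Sf : Set (HeightOneSpectrum (𝓞 K))) γ) with hlam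
  set n := Nat.card {x : XAc (W.baseChange K) p κ vbar (↑Sf : Set (HeightOneSpectrum (𝓞 K))) γ // p • x = 0} with hn
  have hn0 : n ≠ 0 := by
    intro h0
    rw [h0, mul_zero] at h
    exact pow_ne_zero _ hpp.ne_zero h.symm
  refine ⟨h, ?_, fun hfree ↦ ?_⟩
  · -- `p^{lam} ∣ p^{λsub + λquot}`
    have hdvd : p ^ lam ∣ p ^ (lambdaInvariant p Dsub.X + lambdaInvariant p Dquot.X) := ⟨n, h.symm⟩
    exact (Nat.pow_dvd_pow_iff_le_right hpp.one_lt).mp hdvd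
  · haveI : Subsingleton {x : XAc (W.baseChange K) p κ vbar (↑Sf : Set (HeightOneSpectrum (𝓞 K))) γ // p • x = 0} :=
      ⟨fun x y ↦ Subtype.ext ((hfree x.1 x.2).trans (hfree y.1 y.2).symm)⟩
    haveI : Nonempty {x : XAc (W.baseChange K) p κ vbar (↑Sf : Set (HeightOneSpectrum (𝓞 K))) γ // p • x = 0} :=
      ⟨⟨0, smul_zero _⟩⟩
    have hn1 : n = 1 := Nat.card_unique
    rw [hn1, mul_one] at h
    exact Nat.pow_right_injective hpp.two_le h

end Summit.BirchSwinnertonDyer.BirchSwinnertonDyer.Theorems.ResidualDevissageNonsplitLambdaIdentity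

end
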